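import Literature.Analysis.FluidPDE.NSUniqueness2DTruncatedBalance
import Literature.Analysis.FluidPDE.NSHopfGalerkinExistence
import HarnessLib

/-!
# The cross identity `⟨u(t), U(t)⟩` between a Leray–Hopf solution and a Galerkin-type field on
  the flat torus

Analysis/FluidPDE support file for the discharge of the named fact
`Literature.Analysis.FluidPDE.galerkin_tendsto_lerayHopf_torus2` (`NSEnstrophyBalance2DGalerkin`;
Foias–Manley–Rosa–Temam 2001, Ch. II Thm. 7.3: Galerkin trajectories converge to every Leray–Hopf
solution on `𝕋²`). That discharge is Serrin's weak–strong energy method (Serrin 1963, §4;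
Robinson–Rodrigo–Sadowski 2016, Lemma 8.18 and proof of Thm. 6.10, "third display": the cross
identity `⟨u(t), v(t)⟩ + 2ν∫₀ᵗ⟨∇u, ∇v⟩ = ‖u₀‖² - ∫₀ᵗ b(w, w, u)`), with the *Galerkin
approximations* in the role of the strong solution. Its first ingredient, proved here in every
dimension, is the product rule for the pairing of a Leray–Hopf solution `u` on `T^d × [0,T)` with
a time-dependent real trigonometric polynomial `U(s) = realTrigPoly S (α s)` whose coefficient
curve `α` is `C¹` on `[0, T]` with values in the Galerkin phase space (real, divergence-free
coefficient vectors, `galerkinSubspace S`):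

`⟨u(t), U(t)⟩ = ⟨u₀, U(0)⟩ + ∫_{(0,t]} ( ⟨u(s), U'(s)⟩ + ∫ (⟪u, (u·∇)U⟫ + ν⟪u, ΔU⟫ + ⟪f, U⟫)(s) ) ds`

for every `t ∈ (0, T]`, `U'(s) = realTrigPoly S (α' s)`
(`Torus.IsLerayHopfOn.integral_inner_galerkin_eq_add_setIntegral`), together with the
integrability on `(0, T)` of the two time integrands.

## Proof

* `exists_coord_clm` — coordinates on a submodule `W` of a finite-dimensional real space `A`,
  extended to continuous linear functionals `ℓᵢ` on `A` with `∑ᵢ ℓᵢ(v) bᵢ = v` on `W`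
  (a basis of `W` and a linear left inverse of the inclusion).
* `mul_sub_mul_eq_setIntegral_of_primitive` — integration by parts of a `C¹` function `a` on
  `[0, t]` against a primitive `g = g₀ + ∫_{(0,·]} F` of an `L¹` function:
  `a(t)g(t) - a(0)g₀ = ∫_{(0,t]} (a'g + aF)` (Fubini on the triangle,
  `FunctionSpaces.setIntegral_mul_setIntegral_add_symm`, and the fundamental theorem of calculus
  for `a`; no differentiability of `g` is used).
* `pairing_curve_identity` — the abstract product rule: if `p t c = p₀ c + ∫_{(0,t]} q s c` for
  `c ∈ W` with `p t`, `p₀`, `q s` real-linear (the last for a.e. `s`), then along a `C¹` curve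
  `α` in `W`, `p t (α t) = p₀ (α 0) + ∫_{(0,t]} (p s (α' s) + q s (α s))` (expand in the
  coordinates and sum the scalar integrations by parts).
* The instance: `p t c = ⟨u(t), realTrigPoly S c⟩`, `q s c` the flux of the time-sliced weak
  formulation (`Torus.IsLerayHopfOn.integral_inner_eq_add_setIntegral`, Temam 1984, Ch. III
  (1.25)), which holds for every Galerkin field since these are smooth and divergence free
  (`galerkin_slice_props`); linearity in `c` is `isLinearMap_integral_inner_galerkin` /
  `isLinearMap_flux_galerkin`.

## Mathlib / tree search

Mathlib (this pin): `LinearMap.exists_leftInverse_of_injective`, `Module.finBasis`,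
`LinearMap.toContinuousLinearMap`, `intervalIntegral.integral_eq_sub_of_hasDeriv_right_of_le`,
`IntegrableOn.continuousOn_mul_of_subset`, `ContDiffAt.laplacian_add`; no integration by parts
against an absolutely continuous factor (searched `integral_mul_deriv`, `AbsolutelyContinuous`
in `MeasureTheory/Integral`). Tree: the time-sliced weak formulation and the flux integrability
(`LerayHopfTimeSliceTorus`, `NSUniqueness2DTruncatedBalance` for the a.e. integrability of the
force slices), the Galerkin dictionary (`NSGalerkinFourier`,
`NSHopfGalerkinExistence`), Fubini on the triangle (`DuBoisReymondAE`).

## References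

* J. Serrin, *The initial value problem for the Navier–Stokes equations*, in: Nonlinear Problems
  (Madison 1962), Univ. Wisconsin Press 1963, §4.
* J. C. Robinson, J. L. Rodrigo, W. Sadowski, *The three-dimensional Navier–Stokes equations*,
  CUP 2016, Thm. 4.4 (4.5), Thm. 6.10, Lemma 8.18.
* R. Temam, *Navier–Stokes Equations*, 3rd ed., North-Holland 1984, Ch. III §1.1 (1.25),
  Lemma 1.2.
* C. Foias, O. Manley, R. Rosa, R. Temam, *Navier–Stokes Equations and Turbulence*, CUP 2001,
  Ch. II §7, Thm. 7.3.
-/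

noncomputable section

open MeasureTheory TopologicalSpace Set Function Filter InnerProductSpace UnitAddTorus
open scoped RealInnerProductSpace ENNReal NNReal ContDiff Topology

namespace Literature.Analysis.FluidPDE

/-! ### Coordinates on a submodule, extended to the ambient space -/

/-- **Coordinates on a submodule.** For a submodule `W` of a finite-dimensional real normed
space `A` there are vectors `b₁, …, bₙ ∈ W` and continuous linear functionals `ℓ₁, …, ℓₙ` on all
of `A` with `∑ᵢ ℓᵢ(v) bᵢ = v` for every `v ∈ W` (a basis of `W`, its coordinate functionals
composed with a linear left inverse of the inclusion `W → A`). [folklore] -/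
theorem exists_coord_clm {A : Type*} [NormedAddCommGroup A] [NormedSpace ℝ A]
    [FiniteDimensional ℝ A] (W : Submodule ℝ A) :
    ∃ (n : ℕ) (b : Fin n → A) (ℓ : Fin n → A →L[ℝ] ℝ),
      (∀ i, b i ∈ W) ∧ ∀ v ∈ W, ∑ i, ℓ i v • b i = v := by
  set bW := Module.finBasis ℝ W with hbW
  obtain ⟨P, hP⟩ := LinearMap.exists_leftInverse_of_injective W.subtype (Submodule.ker_subtype W)
  refine ⟨Module.finrank ℝ W, fun i => (bW i : A),
    fun i => LinearMap.toContinuousLinearMap ((bW.coord i).comp P), fun i => (bW i).2, ?_⟩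
  intro v hv
  have hPv : P v = ⟨v, hv⟩ := by
    have := LinearMap.congr_fun hP ⟨v, hv⟩
    simpa using this
  have hsum := bW.sum_repr (P v)
  have hcoe := congrArg (fun w : W => (w : A)) hsum
  simp only [Submodule.coe_sum, Submodule.coe_smul_of_tower] at hcoe
  rw [hPv] at hcoe
  simpa [LinearMap.coe_toContinuousLinearMap', hPv] using hcoe

/-! ### Integration by parts against a primitive -/

/-- **Integration by parts of a `C¹` function against a primitive.** Let `a` be differentiable
within `[0, t]` with derivative `a'` continuous on `[0, t]`, `F ∈ L¹(0, t)`, and let `g` be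
integrable on `(0, t)` with `g(s) = g₀ + ∫_{(0,s]} F` for every `s ∈ (0, t]`. Then
`a(t) g(t) - a(0) g₀ = ∫_{(0,t]} (a'(s) g(s) + a(s) F(s)) ds`
(the product rule for the absolutely continuous `g`, proved without differentiating `g`: Fubini
on the triangle `{r ≤ s}` and `∫_{(0,r]} a' = a(r) - a(0)`; cf. Temam 1984, Ch. III, Lemma 1.2). [folklore] -/
theorem mul_sub_mul_eq_setIntegral_of_primitive {a a' g F : ℝ → ℝ} {g₀ t : ℝ} (ht : 0 < t)
    (hderiv : ∀ s ∈ Icc 0 t, HasDerivWithinAt a (a' s) (Icc 0 t) s)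
    (ha' : ContinuousOn a' (Icc 0 t)) (hF : IntegrableOn F (Ioo 0 t))
    (hg_int : IntegrableOn g (Ioo 0 t)) (hg : ∀ s ∈ Ioc 0 t, g s = g₀ + ∫ r in Ioc 0 s, F r) :
    a t * g t - a 0 * g₀ = ∫ s in Ioc 0 t, (a' s * g s + a s * F s) := by
  have ha_cont : ContinuousOn a (Icc 0 t) := fun s hs => (hderiv s hs).continuousWithinAt
  -- the fundamental theorem of calculus for `a`
  have hFTC : ∀ r ∈ Icc 0 t, ∫ s in Ioc 0 r, a' s = a r - a 0 := by
    intro r hr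
    rw [← intervalIntegral.integral_of_le hr.1]
    refine intervalIntegral.integral_eq_sub_of_hasDeriv_right_of_le hr.1
      (ha_cont.mono (Icc_subset_Icc le_rfl hr.2)) (fun s hs => ?_)
      ((ha'.mono (by rw [uIcc_of_le hr.1]; exact Icc_subset_Icc le_rfl hr.2)).intervalIntegrable)
    have h := hderiv s ⟨hs.1.le, hs.2.le.trans hr.2⟩
    exact (h.hasDerivAt (Icc_mem_nhds hs.1 (hs.2.trans_le hr.2))).hasDerivWithinAt
  -- integrability on `(0, t]`
  have hF' : IntegrableOn F (Ioc 0 t) :=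
    (integrableOn_congr_set_ae (Ioo_ae_eq_Ioc (μ := volume) (a := 0) (b := t))).1 hF
  have hg' : IntegrableOn g (Ioc 0 t) :=
    (integrableOn_congr_set_ae (Ioo_ae_eq_Ioc (μ := volume) (a := 0) (b := t))).1 hg_int
  have ha'_int : IntegrableOn a' (Ioc 0 t) := ha'.integrableOn_Icc.mono_set Ioc_subset_Icc_self
  have ha'g : IntegrableOn (fun s => a' s * g s) (Ioc 0 t) :=
    hg'.continuousOn_mul_of_subset ha' isCompact_Icc measurableSet_Ioc Ioc_subset_Icc_self
  have haF : IntegrableOn (fun s => a s * F s) (Ioc 0 t) :=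
    hF'.continuousOn_mul_of_subset ha_cont isCompact_Icc measurableSet_Ioc Ioc_subset_Icc_self
  have hFa : IntegrableOn (fun s => F s * a s) (Ioc 0 t) :=
    hF'.mul_continuousOn_of_subset ha_cont measurableSet_Ioc isCompact_Icc Ioc_subset_Icc_self
  -- Fubini on the triangle
  have key := FunctionSpaces.setIntegral_mul_setIntegral_add_symm ha'_int hF'
  have h1 : ∫ s in Ioc 0 t, a' s * ∫ r in Ioc 0 s, F r =
      (∫ s in Ioc 0 t, a' s * g s) - g₀ * (a t - a 0) := by
    rw [← hFTC t ⟨ht.le, le_rfl⟩, ← integral_const_mul, ← integral_sub ha'g (ha'_int.const_mul _)]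
    refine setIntegral_congr_fun measurableSet_Ioc fun s hs => ?_
    rw [hg s hs]
    ring
  have h2 : ∫ r in Ioc 0 t, F r * ∫ s in Ioc 0 r, a' s =
      (∫ r in Ioc 0 t, F r * a r) - a 0 * ∫ r in Ioc 0 t, F r := by
    rw [← integral_const_mul, ← integral_sub hFa (hF'.const_mul _)]
    refine setIntegral_congr_fun measurableSet_Ioc fun r hr => ?_
    rw [hFTC r ⟨hr.1.le, hr.2⟩]
    ring
  rw [h1, h2, hFTC t ⟨ht.le, le_rfl⟩] at key
  have h3 : ∫ r in Ioc 0 t, F r * a r = ∫ s in Ioc 0 t, a s * F s :=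
    integral_congr_ae (ae_of_all _ fun s => mul_comm _ _)
  rw [h3] at key
  rw [integral_add ha'g haF, hg t ⟨ht, le_rfl⟩]
  linear_combination (-1 : ℝ) * key

/-! ### The abstract product rule for pairings along a `C¹` curve in a subspace -/

/-- **Product rule for linear pairings along a `C¹` curve.** Let `W` be a submodule of a
finite-dimensional real normed space `A`, and let `p t`, `p₀`, `q s : A → ℝ` be real-linear
(`p t` for `t ∈ [0,T]`, `q s` for a.e. `s ∈ (0,T)`), with `s ↦ p s c`, `s ↦ q s c` integrable on
`(0, T)` and `p t c = p₀ c + ∫_{(0,t]} q s c ds` for every `c ∈ W` and `t ∈ (0, T]`. If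
`α : [0,T] → W` has derivative `α'` within `[0,T]`, continuous and `W`-valued, then
`s ↦ p s (α' s)` and `s ↦ q s (α s)` are integrable on `(0, T)` and
`p t (α t) = p₀ (α 0) + ∫_{(0,t]} (p s (α' s) + q s (α s)) ds` for every `t ∈ (0, T]`
(coordinates `exists_coord_clm` and `mul_sub_mul_eq_setIntegral_of_primitive` for each
coordinate). [folklore] -/
theorem pairing_curve_identity {A : Type*} [NormedAddCommGroup A] [NormedSpace ℝ A]
    [FiniteDimensional ℝ A] (W : Submodule ℝ A) {T : ℝ} {p q : ℝ → A → ℝ}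
    {p₀ : A → ℝ} (hp_lin : ∀ t ∈ Icc 0 T, IsLinearMap ℝ (p t)) (hp₀ : IsLinearMap ℝ p₀)
    (hq_lin : ∀ᵐ s ∂(volume.restrict (Ioo 0 T)), IsLinearMap ℝ (q s))
    (hp_int : ∀ c ∈ W, IntegrableOn (fun s => p s c) (Ioo 0 T))
    (hq_int : ∀ c ∈ W, IntegrableOn (fun s => q s c) (Ioo 0 T))
    (hpq : ∀ c ∈ W, ∀ t ∈ Ioc 0 T, p t c = p₀ c + ∫ s in Ioc 0 t, q s c)
    {α α' : ℝ → A} (hα : ∀ t ∈ Icc 0 T, α t ∈ W) (hα' : ∀ t ∈ Icc 0 T, α' t ∈ W)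
    (hderiv : ∀ t ∈ Icc 0 T, HasDerivWithinAt α (α' t) (Icc 0 T) t)
    (hcont : ContinuousOn α' (Icc 0 T)) :
    IntegrableOn (fun s => p s (α' s)) (Ioo 0 T) ∧ IntegrableOn (fun s => q s (α s)) (Ioo 0 T) ∧
      ∀ t ∈ Ioc 0 T, p t (α t) = p₀ (α 0) + ∫ s in Ioc 0 t, (p s (α' s) + q s (α s)) := by
  obtain ⟨n, b, ℓ, hb, hrec⟩ := exists_coord_clm W
  have hα_cont : ContinuousOn α (Icc 0 T) := fun s hs => (hderiv s hs).continuousWithinAt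
  -- coordinates of the curve and of its derivative
  set a : Fin n → ℝ → ℝ := fun i s => ℓ i (α s) with ha_def
  set a' : Fin n → ℝ → ℝ := fun i s => ℓ i (α' s) with ha'_def
  have ha_deriv : ∀ i, ∀ s ∈ Icc 0 T, HasDerivWithinAt (a i) (a' i s) (Icc 0 T) s := fun i s hs =>
    (ℓ i).hasFDerivAt.comp_hasDerivWithinAt s (hderiv s hs)
  have ha_contOn : ∀ i, ContinuousOn (a i) (Icc 0 T) := fun i =>
    (ℓ i).continuous.comp_continuousOn hα_cont
  have ha'_contOn : ∀ i, ContinuousOn (a' i) (Icc 0 T) := fun i =>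
    (ℓ i).continuous.comp_continuousOn hcont
  -- expansions along the coordinates
  have hexp : ∀ (L : A → ℝ), IsLinearMap ℝ L → ∀ v ∈ W, L v = ∑ i, ℓ i v * L (b i) := by
    intro L hL v hv
    conv_lhs => rw [← hrec v hv]
    rw [show L = hL.mk' L from rfl, map_sum]
    simp only [LinearMap.map_smul, smul_eq_mul]
  have hE1 : ∀ t ∈ Icc 0 T, p t (α t) = ∑ i, a i t * p t (b i) := fun t ht =>
    hexp (p t) (hp_lin t ht) (α t) (hα t ht)
  have hE1' : ∀ t ∈ Icc 0 T, p t (α' t) = ∑ i, a' i t * p t (b i) := fun t ht =>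
    hexp (p t) (hp_lin t ht) (α' t) (hα' t ht)
  have hE2 : ∀ᵐ s ∂(volume.restrict (Ioo 0 T)), q s (α s) = ∑ i, a i s * q s (b i) := by
    filter_upwards [hq_lin, ae_restrict_mem measurableSet_Ioo] with s hs hsI
    exact hexp (q s) hs (α s) (hα s (Ioo_subset_Icc_self hsI))
  -- integrability of the coordinate products
  have hint_p : ∀ i, IntegrableOn (fun s => a' i s * p s (b i)) (Ioo 0 T) := fun i =>
    (hp_int (b i) (hb i)).continuousOn_mul_of_subset (ha'_contOn i) isCompact_Icc
      measurableSet_Ioo Ioo_subset_Icc_self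
  have hint_q : ∀ i, IntegrableOn (fun s => a i s * q s (b i)) (Ioo 0 T) := fun i =>
    (hq_int (b i) (hb i)).continuousOn_mul_of_subset (ha_contOn i) isCompact_Icc
      measurableSet_Ioo Ioo_subset_Icc_self
  have hIp : IntegrableOn (fun s => p s (α' s)) (Ioo 0 T) := by
    refine (integrable_finsetSum Finset.univ fun i _ => hint_p i).congr ?_
    filter_upwards [ae_restrict_mem measurableSet_Ioo] with s hs
    exact (hE1' s (Ioo_subset_Icc_self hs)).symm
  have hIq : IntegrableOn (fun s => q s (α s)) (Ioo 0 T) := by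
    refine (integrable_finsetSum Finset.univ fun i _ => hint_q i).congr ?_
    filter_upwards [hE2] with s hs
    exact hs.symm
  refine ⟨hIp, hIq, fun t ht => ?_⟩
  -- integration by parts coordinatewise on `[0, t]`
  have hsub : Icc 0 t ⊆ Icc 0 T := Icc_subset_Icc_right ht.2
  have hIBP : ∀ i, a i t * p t (b i) - a i 0 * p₀ (b i) =
      ∫ s in Ioc 0 t, (a' i s * p s (b i) + a i s * q s (b i)) := by
    intro i
    refine mul_sub_mul_eq_setIntegral_of_primitive ht.1 (fun s hs => ?_) ((ha'_contOn i).mono hsub)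
      ((hq_int (b i) (hb i)).mono_set (Ioo_subset_Ioo_right ht.2))
      ((hp_int (b i) (hb i)).mono_set (Ioo_subset_Ioo_right ht.2))
      (fun s hs => hpq (b i) (hb i) s ⟨hs.1, hs.2.trans ht.2⟩)
    exact (ha_deriv i s (hsub hs)).mono hsub
  have hsum := Finset.sum_congr rfl fun i (_ : i ∈ Finset.univ) => hIBP i
  rw [Finset.sum_sub_distrib] at hsum
  -- identify the two sides
  have hL1 : ∑ i, a i t * p t (b i) = p t (α t) := (hE1 t ⟨ht.1.le, ht.2⟩).symm
  have hL0 : ∑ i, a i 0 * p₀ (b i) = p₀ (α 0) :=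
    (hexp p₀ hp₀ (α 0) (hα 0 ⟨le_rfl, (ht.1.trans_le ht.2).le⟩)).symm
  have hint_t : ∀ i, IntegrableOn (fun s => a' i s * p s (b i) + a i s * q s (b i)) (Ioc 0 t) := by
    intro i
    have h := ((hint_p i).add (hint_q i)).mono_set (Ioo_subset_Ioo_right ht.2)
    exact (integrableOn_congr_set_ae (Ioo_ae_eq_Ioc (μ := volume) (a := 0) (b := t))).1 h
  have hR : ∑ i, ∫ s in Ioc 0 t, (a' i s * p s (b i) + a i s * q s (b i)) =
      ∫ s in Ioc 0 t, (p s (α' s) + q s (α s)) := by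
    rw [← integral_finsetSum Finset.univ fun i _ => hint_t i]
    rw [Measure.restrict_congr_set (Ioo_ae_eq_Ioc (μ := volume) (a := 0) (b := t)).symm]
    refine integral_congr_ae ?_
    have hE2t : ∀ᵐ s ∂(volume.restrict (Ioo 0 t)), q s (α s) = ∑ i, a i s * q s (b i) :=
      ae_restrict_of_ae_restrict_of_subset (Ioo_subset_Ioo_right ht.2) hE2
    filter_upwards [hE2t, ae_restrict_mem measurableSet_Ioo] with s hs hsI
    rw [Finset.sum_add_distrib, hs, hE1' s ⟨hsI.1.le, hsI.2.le.trans ht.2⟩]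
  rw [hL1, hL0, hR] at hsum
  linarith

/-! ### Galerkin fields: linearity in the coefficient vector -/

section Galerkin

open Torus FunctionSpaces.Torus

variable {d : Type*} [Fintype d] [DecidableEq d] {S : Finset (d → ℤ)}

omit [DecidableEq d] in
/-- Real scalars pull out of a real trigonometric polynomial:
`realTrigPoly S (r • C) = r • realTrigPoly S C`. [folklore] -/
theorem realTrigPoly_real_smul (S : Finset (d → ℤ)) (r : ℝ) (C : (d → ℤ) → EuclideanSpace ℂ d)
    (x : UnitAddTorus d) : realTrigPoly S (r • C) x = r • realTrigPoly S C x := by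
  simp only [realTrigPoly_apply, trigPoly_apply, Pi.smul_apply, ← map_smul, Finset.smul_sum]
  congr 1
  exact Finset.sum_congr rfl fun k _ => (smul_comm r (mFourier k x) (C k)).symm

omit [DecidableEq d] in
/-- The Galerkin field `c ↦ realTrigPoly S (coeffExt S c)` is additive in `c`. [folklore] -/
theorem realTrigPoly_coeffExt_add (c c' : ↥S → EuclideanSpace ℂ d) :
    realTrigPoly S (coeffExt S (c + c')) = realTrigPoly S (coeffExt S c) + realTrigPoly S (coeffExt S c') := by
  rw [coeffExt_add, realTrigPoly_add]

omit [DecidableEq d] in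
/-- The Galerkin field `c ↦ realTrigPoly S (coeffExt S c)` commutes with real scalars. [folklore] -/
theorem realTrigPoly_coeffExt_smul (r : ℝ) (c : ↥S → EuclideanSpace ℂ d) :
    realTrigPoly S (coeffExt S (r • c)) = r • realTrigPoly S (coeffExt S c) := by
  funext x
  rw [coeffExt_smul, realTrigPoly_real_smul, Pi.smul_apply]

omit [DecidableEq d] in
/-- Additivity of the torus Laplacian on smooth functions (Mathlib `ContDiffAt.laplacian_add` on
the re-centred lifts). [folklore] -/
theorem laplacian_add_apply {F : Type*} [NormedAddCommGroup F] [NormedSpace ℝ F]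
    {g h : UnitAddTorus d → F} (hg : IsSmooth g) (hh : IsSmooth h) (x : UnitAddTorus d) :
    FunctionSpaces.Torus.laplacian (g + h) x =
      FunctionSpaces.Torus.laplacian g x + FunctionSpaces.Torus.laplacian h x := by
  have h2g : ContDiffAt ℝ 2 (liftAt g x) 0 :=
    ((hg.liftAt x).of_le (WithTop.coe_le_coe.mpr le_top)).contDiffAt
  have h2h : ContDiffAt ℝ 2 (liftAt h x) 0 :=
    ((hh.liftAt x).of_le (WithTop.coe_le_coe.mpr le_top)).contDiffAt
  have hl : liftAt (g + h) x = liftAt g x + liftAt h x := rfl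
  simp only [FunctionSpaces.Torus.laplacian, hl]
  exact h2g.laplacian_add h2h

omit [DecidableEq d] in
/-- **The pairing `c ↦ ∫ ⟪w, realTrigPoly S c̄⟫` is real-linear** for an integrable `w`. [folklore] -/
theorem isLinearMap_integral_inner_galerkin {w : UnitAddTorus d → EuclideanSpace ℝ d}
    (hw : Integrable w volume) :
    IsLinearMap ℝ fun c : ↥S → EuclideanSpace ℂ d => ∫ x, ⟪w x, realTrigPoly S (coeffExt S c) x⟫ := by
  have hint : ∀ c : ↥S → EuclideanSpace ℂ d,
      Integrable (fun x => ⟪w x, realTrigPoly S (coeffExt S c) x⟫) volume := fun c =>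
    integrable_inner_of_continuous hw (continuous_realTrigPoly S _)
  refine ⟨fun c c' => ?_, fun r c => ?_⟩
  · rw [← integral_add (hint c) (hint c')]
    refine integral_congr_ae (ae_of_all _ fun x => ?_)
    dsimp only
    rw [realTrigPoly_coeffExt_add, Pi.add_apply, inner_add_right]
  · rw [smul_eq_mul, ← integral_const_mul]
    refine integral_congr_ae (ae_of_all _ fun x => ?_)
    dsimp only
    rw [realTrigPoly_coeffExt_smul, Pi.smul_apply, real_inner_smul_right]

/-- **The flux `c ↦ ∫ (⟪v, (v·∇)Ψ_c⟫ + ν⟪v, ΔΨ_c⟫ + ⟪g, Ψ_c⟫)`, `Ψ_c = realTrigPoly S c̄`, is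
real-linear** for `v ∈ L²` and an integrable `g`. [folklore] -/
theorem isLinearMap_flux_galerkin (ν : ℝ) {v g : UnitAddTorus d → EuclideanSpace ℝ d}
    (hv : MemLp v 2 volume) (hg : Integrable g volume) :
    IsLinearMap ℝ fun c : ↥S → EuclideanSpace ℂ d =>
      ∫ x, (⟪v x, FunctionSpaces.Torus.convect v (realTrigPoly S (coeffExt S c)) x⟫ +
        ν * ⟪v x, FunctionSpaces.Torus.laplacian (realTrigPoly S (coeffExt S c)) x⟫ +
        ⟪g x, realTrigPoly S (coeffExt S c) x⟫) := by
  have hsm : ∀ c : ↥S → EuclideanSpace ℂ d, IsSmooth (realTrigPoly S (coeffExt S c)) := fun c =>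
    isSmooth_realTrigPoly S _
  have hint : ∀ c : ↥S → EuclideanSpace ℂ d,
      Integrable (fun x => ⟪v x, FunctionSpaces.Torus.convect v (realTrigPoly S (coeffExt S c)) x⟫ +
        ν * ⟪v x, FunctionSpaces.Torus.laplacian (realTrigPoly S (coeffExt S c)) x⟫ +
        ⟪g x, realTrigPoly S (coeffExt S c) x⟫) volume := fun c =>
    integrable_nsFluxIntegrand hv hg (hsm c) ν
  have hC1 : ∀ c : ↥S → EuclideanSpace ℂ d, IsContDiff 1 (realTrigPoly S (coeffExt S c)) := fun c =>
    (hsm c).isContDiff (by simp)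
  refine ⟨fun c c' => ?_, fun r c => ?_⟩
  · rw [← integral_add (hint c) (hint c')]
    refine integral_congr_ae (ae_of_all _ fun x => ?_)
    dsimp only
    have hconv : FunctionSpaces.Torus.convect v (realTrigPoly S (coeffExt S (c + c'))) x =
        FunctionSpaces.Torus.convect v (realTrigPoly S (coeffExt S c)) x +
          FunctionSpaces.Torus.convect v (realTrigPoly S (coeffExt S c')) x := by
      simp only [FunctionSpaces.Torus.convect]
      rw [realTrigPoly_coeffExt_add, FunctionSpaces.Torus.fderiv_add (hC1 c) (hC1 c'),
        add_apply]
    have hlap : FunctionSpaces.Torus.laplacian (realTrigPoly S (coeffExt S (c + c'))) x =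
        FunctionSpaces.Torus.laplacian (realTrigPoly S (coeffExt S c)) x +
          FunctionSpaces.Torus.laplacian (realTrigPoly S (coeffExt S c')) x := by
      rw [realTrigPoly_coeffExt_add, laplacian_add_apply (hsm c) (hsm c')]
    rw [hconv, hlap, realTrigPoly_coeffExt_add, Pi.add_apply, inner_add_right, inner_add_right,
      inner_add_right]
    ring
  · rw [smul_eq_mul, ← integral_const_mul]
    refine integral_congr_ae (ae_of_all _ fun x => ?_)
    dsimp only
    have hconv : FunctionSpaces.Torus.convect v (realTrigPoly S (coeffExt S (r • c))) x =
        r • FunctionSpaces.Torus.convect v (realTrigPoly S (coeffExt S c)) x := by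
      simp only [FunctionSpaces.Torus.convect]
      rw [realTrigPoly_coeffExt_smul, FunctionSpaces.Torus.fderiv_const_smul (hC1 c),
        smul_apply]
    have hlap : FunctionSpaces.Torus.laplacian (realTrigPoly S (coeffExt S (r • c))) x =
        r • FunctionSpaces.Torus.laplacian (realTrigPoly S (coeffExt S c)) x := by
      rw [realTrigPoly_coeffExt_smul,
        show r • realTrigPoly S (coeffExt S c) = fun y => r • realTrigPoly S (coeffExt S c) y from rfl,
        Torus.laplacian_const_smul (hsm c)]
    rw [hconv, hlap, realTrigPoly_coeffExt_smul, Pi.smul_apply, real_inner_smul_right,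
      real_inner_smul_right, real_inner_smul_right]
    ring

end Galerkin

/-! ### The cross identity -/

namespace Torus

variable {d : Type*} [Fintype d] [DecidableEq d]

variable {T ν : ℝ} {f u : ℝ → UnitAddTorus d → EuclideanSpace ℝ d}
  {u₀ : UnitAddTorus d → EuclideanSpace ℝ d} {S : Finset (d → ℤ)}

/-- **The cross identity** (Serrin 1963, §4; Robinson–Rodrigo–Sadowski 2016, Lemma 8.18, for a
Galerkin-type strong field). Let `u` be a Leray–Hopf weak solution on `T^d × [0, T)`, `T > 0`,
with viscosity `ν`, datum `u₀ ∈ L¹` and a space–time measurable force `f`, `∫₀ᵀ∫‖f‖² < ∞`; let `S`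
be a symmetric finite set of frequencies and `α : [0,T] → galerkinSubspace S` a coefficient curve
with derivative `α'` within `[0, T]`, continuous and valued in `galerkinSubspace S`; put
`U(s) = realTrigPoly S (α s)`, `U'(s) = realTrigPoly S (α' s)`. Then
(i) `s ↦ ⟨u(s), U'(s)⟩` is integrable on `(0,T)`; (ii) the flux
`s ↦ ∫ (⟪u, (u·∇)U⟫ + ν⟪u, ΔU⟫ + ⟪f, U⟫)(s)` is integrable on `(0,T)`; (iii) for every
`t ∈ (0, T]`,
`⟨u(t), U(t)⟩ = ⟨u₀, U(0)⟩ + ∫_{(0,t]} (⟨u(s), U'(s)⟩ + ∫ (⟪u, (u·∇)U⟫ + ν⟪u, ΔU⟫ + ⟪f, U⟫)(s)) ds`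
(the time-sliced weak formulation, Temam 1984, Ch. III (1.25), along the basis fields of the
Galerkin space, and `pairing_curve_identity`). [cite: RobinsonRodrigoSadowski2016, Lemma 8.18] -/
theorem IsLerayHopfOn.galerkin_cross_identity (hu : IsLerayHopfOn T ν f u₀ u) (hT : 0 < T)
    (hfm : AEStronglyMeasurable (FunctionSpaces.Torus.stLift f) (volume.restrict (Ioo 0 T ×ˢ univ)))
    (hf₂ : ∫⁻ t in Ioo 0 T, ∫⁻ x, ‖f t x‖ₑ ^ 2 < ⊤) (hu₀ : Integrable u₀ volume)
    (hS : ∀ k ∈ S, -k ∈ S) {α α' : ℝ → ↥S → EuclideanSpace ℂ d}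
    (hα : ∀ t ∈ Icc 0 T, α t ∈ galerkinSubspace S) (hα' : ∀ t ∈ Icc 0 T, α' t ∈ galerkinSubspace S)
    (hderiv : ∀ t ∈ Icc 0 T, HasDerivWithinAt α (α' t) (Icc 0 T) t)
    (hcont : ContinuousOn α' (Icc 0 T)) :
    IntegrableOn (fun s => ∫ x, ⟪u s x, FunctionSpaces.Torus.realTrigPoly S
        (FunctionSpaces.Torus.coeffExt S (α' s)) x⟫) (Ioo 0 T) ∧
    IntegrableOn (fun s => ∫ x,
        (⟪u s x, FunctionSpaces.Torus.convect (u s)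
            (FunctionSpaces.Torus.realTrigPoly S (FunctionSpaces.Torus.coeffExt S (α s))) x⟫ +
          ν * ⟪u s x, FunctionSpaces.Torus.laplacian
            (FunctionSpaces.Torus.realTrigPoly S (FunctionSpaces.Torus.coeffExt S (α s))) x⟫ +
          ⟪f s x, FunctionSpaces.Torus.realTrigPoly S (FunctionSpaces.Torus.coeffExt S (α s)) x⟫))
      (Ioo 0 T) ∧
    ∀ t ∈ Ioc 0 T,
      ∫ x, ⟪u t x, FunctionSpaces.Torus.realTrigPoly S (FunctionSpaces.Torus.coeffExt S (α t)) x⟫ =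
        (∫ x, ⟪u₀ x, FunctionSpaces.Torus.realTrigPoly S (FunctionSpaces.Torus.coeffExt S (α 0)) x⟫) +
        ∫ s in Ioc 0 t,
          ((∫ x, ⟪u s x, FunctionSpaces.Torus.realTrigPoly S
              (FunctionSpaces.Torus.coeffExt S (α' s)) x⟫) +
            ∫ x, (⟪u s x, FunctionSpaces.Torus.convect (u s)
                (FunctionSpaces.Torus.realTrigPoly S (FunctionSpaces.Torus.coeffExt S (α s))) x⟫ +
              ν * ⟪u s x, FunctionSpaces.Torus.laplacian
                (FunctionSpaces.Torus.realTrigPoly S (FunctionSpaces.Torus.coeffExt S (α s))) x⟫ +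
              ⟪f s x, FunctionSpaces.Torus.realTrigPoly S
                (FunctionSpaces.Torus.coeffExt S (α s)) x⟫)) := by
  -- the pairings
  set p : ℝ → (↥S → EuclideanSpace ℂ d) → ℝ := fun t c =>
    ∫ x, ⟪u t x, FunctionSpaces.Torus.realTrigPoly S (FunctionSpaces.Torus.coeffExt S c) x⟫ with hp
  set p₀ : (↥S → EuclideanSpace ℂ d) → ℝ := fun c =>
    ∫ x, ⟪u₀ x, FunctionSpaces.Torus.realTrigPoly S (FunctionSpaces.Torus.coeffExt S c) x⟫ with hp₀
  set q : ℝ → (↥S → EuclideanSpace ℂ d) → ℝ := fun s c =>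
    ∫ x, (⟪u s x, FunctionSpaces.Torus.convect (u s)
        (FunctionSpaces.Torus.realTrigPoly S (FunctionSpaces.Torus.coeffExt S c)) x⟫ +
      ν * ⟪u s x, FunctionSpaces.Torus.laplacian
        (FunctionSpaces.Torus.realTrigPoly S (FunctionSpaces.Torus.coeffExt S c)) x⟫ +
      ⟪f s x, FunctionSpaces.Torus.realTrigPoly S (FunctionSpaces.Torus.coeffExt S c) x⟫) with hq
  have hp_lin : ∀ t ∈ Icc 0 T, IsLinearMap ℝ (p t) := fun t ht =>
    isLinearMap_integral_inner_galerkin ((hu.memLp t ht).integrable one_le_two)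
  have hp₀_lin : IsLinearMap ℝ p₀ := isLinearMap_integral_inner_galerkin hu₀
  have hq_lin : ∀ᵐ s ∂(volume.restrict (Ioo 0 T)), IsLinearMap ℝ (q s) := by
    filter_upwards [ae_integrable_force_slice hfm hf₂, ae_restrict_mem measurableSet_Ioo]
      with s hs hsI
    exact isLinearMap_flux_galerkin ν (hu.memLp s (Ioo_subset_Icc_self hsI)) hs
  have hprops : ∀ c ∈ galerkinSubspace S,
      FunctionSpaces.Torus.IsSmooth (FunctionSpaces.Torus.realTrigPoly S (FunctionSpaces.Torus.coeffExt S c)) ∧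
        FunctionSpaces.Torus.IsDivFree (FunctionSpaces.Torus.realTrigPoly S (FunctionSpaces.Torus.coeffExt S c)) :=
    fun c hc => ⟨(galerkin_slice_props hS hc).1, (galerkin_slice_props hS hc).2.1⟩
  have hp_int : ∀ c ∈ galerkinSubspace S, IntegrableOn (fun s => p s c) (Ioo 0 T) := fun c hc =>
    hu.integrableOn_integral_inner (hprops c hc).1.continuous
  have hq_int : ∀ c ∈ galerkinSubspace S, IntegrableOn (fun s => q s c) (Ioo 0 T) := fun c hc =>
    hu.integrableOn_flux hfm hf₂ (hprops c hc).1
  have hpq : ∀ c ∈ galerkinSubspace S, ∀ t ∈ Ioc 0 T, p t c = p₀ c + ∫ s in Ioc 0 t, q s c :=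
    fun c hc t ht => hu.integral_inner_eq_add_setIntegral hT hfm hf₂ (hprops c hc).1 (hprops c hc).2 ht
  exact pairing_curve_identity (galerkinSubspace S) hp_lin hp₀_lin hq_lin hp_int hq_int hpq hα hα'
    hderiv hcont

end Torus

end Literature.Analysis.FluidPDE
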